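import Literature.AlgebraicGeometry.DuqueFrancoVillaflor2025.JoinHilbertFunction
import HarnessLib

/-!
# The first two codimension gaps of the Hodge locus through the Fermat variety (Villaflor, CCM 2022)

R. Villaflor Loyola, *Small codimension components of the Hodge locus containing the Fermat variety*,
Commun. Contemp. Math. 24 (2022) 2150053 = arXiv:2001.01019 [Villaflorloyola2021]. Verbatim from the held
text (chunks p0003–p0005, p0010):

> [(cota), Otwinowska for `d ≫ n`, Movasati [GMCD-NL] at the Fermat point for `d ≥ 2 + 4/n`:]
> `codim_T Σ ≥ C(n/2+d, d) − (n/2+1)²`, with equality if and only if `Σ` is the locus of hypersurfaces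
> containing a linear subvariety of dimension `n/2`.
>
> **Theorem 1.1.** Let `n` be an even number and `d` be such that […] (i.e. `d ≠ 1,2,3,4,6`). Consider a
> component `Σ` of `HL_{n,d}` passing through the Fermat variety […]. The equality in (cota) holds if and only
> if `Σ = {t ∈ T : X_t contains a linear subvariety of dimension n/2}`. In fact, for any polydisc
> `0 ∈ Δ ⊆ T` and for any `λ ∈ Γ(Δ, R^nπ_*ℤ)` such that `0 ∈ V_λ`,
> `codim_{T_0T} T_0V_λ = C(n/2+d, d) − (n/2+1)²` if and only if `λ(0)_prim = a[ℙ^{n/2}]_prim` […].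
>
> **Theorem 1.3.** Let `n` be an even number, `d` be a number such that […] (i.e. `d ≠ 1,2,3,4,6`), `0 ∈ HL_{n,d}`
> be the Fermat variety and `0 ∈ Σ` be a component of the Hodge locus different from (complin). Then
> `codim_T Σ ≥ C(n/2+d, d) + C(n/2+d−1, d−1) − (3n²/8 + 9n/4 + 2)`. In fact for `d ≥ max{4, 2+6/n}`, if
> `0 ∈ Δ ⊆ T` is a polydisc and `λ ∈ Γ(Δ,R^nπ_*ℤ)` is such that `0 ∈ V_λ` but (igualdad1) does not hold, then
> `codim_{T_0T} T_0V_λ ≥ C(n/2+d, d) + C(n/2+d−1, d−1) − (3n²/8 + 9n/4 + 2)`. Furthermore, if the equality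
> in (desteo2) is attained and `n ≥ 4`, then there exists a complete intersection `Z ⊆ ℙ^{n+1}` of type
> `(1,1,…,1,2)` such that `I(Z) ⊆ J^{F,λ}`. If in addition `d ≥ 5` and `F ∈ (J^{F,λ})²`, then `Z ⊆ X_0` and
> `λ(0)_prim = a[Z]_prim` for some `a ∈ ℚ^×`.
>
> [Abstract:] "among all the local Hodge loci associated to a non-linear cycle passing through Fermat, the
> ones associated to a complete intersection cycle of type `(1,1,…,1,2)` attain the minimal possible
> codimension of their Zariski tangent spaces. This […] generalizes a result of Voisin about the first gap
> […]"; [§1, on `n = 2`:] "Voisin [voisin1988] (and independently Green) proved that the unique component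
> of the Noether-Lefschetz locus of minimal codimension [`d − 3`] corresponds to the locus of surfaces
> containing a line. Later Voisin [voisin89] proved that there are no components of codimension bigger
> than `d−3` and less than `2d−7`, and the unique component of codimension `2d−7` corresponds to the
> locus of surfaces containing a conic."; Remark 4.1: "the condition `d ≥ 2+6/n` cannot be improved since
> for `(n,d) = (2,4), (4,3)` the equality in (des1) is attained by all local Hodge loci `V_λ`."

The codimension of the Zariski tangent space of the Hodge locus of a complete intersection of multidegree
`(d₁,…,d_{k+1})` in a degree-`e` hypersurface of `ℙ^{2k+1}` is the Hilbert function `h_I(e)`, `I` of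
multidegree `(d₁,…,d_{k+1}, e−d_{k+1},…,e−d₁)` (Kloosterman, Rend. Sem. Mat. Univ. Padova 148 (2022),
Prop. 3.2 / Prop. 4.13 [Kloosterman2023] — the tree's `Kloosterman2023.ciLocusCodim`).

## What this file PROVES (arithmetic only; no geometry, no new fact)
* `secondGapBound n d` (Thm. 1.3's right-hand side, verbatim over `ℚ`) and `movasatiBound n d` ((cota));
* `n = 2`: `movasatiBound 2 d = d − 3` and `secondGapBound 2 d = 2d − 7` — Voisin's two gaps as Villaflor
  states them (`movasatiBound_two`, `secondGapBound_two`);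
* THE IDENTITY behind "complete intersections of type `(1,1,…,1,2)` attain the bound": for every `k = n/2 ≥ 1`
  and every `d ≥ 4`, `secondGapBound (2k) d = h_I(d)` for `I` of multidegree `(1^k, 2, d−2, (d−1)^k)`, i.e.
  `= Kloosterman2023.ciLocusCodim (1,…,1,2) d` (`secondGapBound_eq_ciLocusCodim`; integral form
  `two_mul_ciLocusCodim_ones_two`), proved from the join/convolution calculus of
  `DuqueFrancoVillaflor2025.JoinHilbertFunction` (the CI `(1,…,1,2)` Hilbert function is the join
  `φ₃ * φ_{d−1} * φ_d^{*k}`); the identity FAILS at `d = 3` (`secondGapBound_cubic_fourfold`: `−1 ≠ 1`),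
  matching the printed hypothesis `d ≥ max{4, 2+6/n}` and Remark 4.1;
* values: `(n,d) = (4,4) ↦ 8`, `(6,4) ↦ 26`, `(4,5) ↦ 19`, `(4,6) ↦ 32` (= the `(1,1,2)` entry of Movasati's
  sextic-fourfold table, tree `Kloosterman2023.movasati_sexticFourfold_ciTable`), `(8,4) ↦ 61`;
* `movasatiBound (2k) d = Kloosterman2023.linC (k+1) (k+1) d` for `d ≥ 3` (from
  `DuqueFrancoVillaflor2025.linC_closed_form`).

HONEST FRAMING (cell pub-hlocus): certified instances and evidence bearing on the general Hodge conjecture;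
no claim.
-/

namespace Literature.AlgebraicGeometry.Villaflor2022

open Finset
open Literature.AlgebraicGeometry.Kloosterman2023 (ciHilbert ciHilbert_cons ciHilbert_one_cons ciLocusCodim
  propIdealDegrees linC)
open Literature.AlgebraicGeometry.DuqueFrancoVillaflor2025

/-! ## The two printed bounds -/

/-- (cota): `C(n/2+d, d) − (n/2+1)²`, the codimension of the locus of hypersurfaces containing a `ℙ^{n/2}`
(Otwinowska `d ≫ n`; Movasati at the Fermat point, `d ≥ 2+4/n`). [cite: Villaflorloyola2021, Thm. 1.1 and (cota)] -/
def movasatiBound (n d : ℕ) : ℤ := ((n / 2 + d).choose d : ℤ) - (((n / 2 + 1) ^ 2 : ℕ) : ℤ)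

/-- Thm. 1.3's bound: `C(n/2+d, d) + C(n/2+d−1, d−1) − (3n²/8 + 9n/4 + 2)` (verbatim, over `ℚ`).
[cite: Villaflorloyola2021, Thm. 1.3] -/
def secondGapBound (n d : ℕ) : ℚ :=
  ((n / 2 + d).choose d : ℚ) + ((n / 2 + d - 1).choose (d - 1) : ℚ) -
    (3 * (n : ℚ) ^ 2 / 8 + 9 * (n : ℚ) / 4 + 2)

/-! ## Surfaces (`n = 2`): Voisin's gaps `d − 3` and `2d − 7` -/

/-- `n = 2`: the minimal codimension is `d − 3` (surfaces containing a line; Voisin 1988, Green 1989, as quoted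
in the introduction). [cite: Villaflorloyola2021, §1 (Voisin/Green)] -/
theorem movasatiBound_two (d : ℕ) : movasatiBound 2 d = (d : ℤ) - 3 := by
  unfold movasatiBound
  simp only [show (2 : ℕ) / 2 = 1 from rfl]
  rw [Nat.add_comm 1 d, Nat.choose_succ_self_right]
  push_cast
  ring

/-- `n = 2`: Thm. 1.3's bound is `2d − 7` (surfaces containing a conic; Voisin 1989, as quoted in the
introduction), for `d ≥ 1`. [cite: Villaflorloyola2021, Thm. 1.3 and §1 (Voisin)] -/
theorem secondGapBound_two (d : ℕ) (hd : 1 ≤ d) : secondGapBound 2 d = 2 * (d : ℚ) - 7 := by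
  obtain ⟨m, rfl⟩ : ∃ m, d = m + 1 := ⟨d - 1, by omega⟩
  unfold secondGapBound
  simp only [show (2 : ℕ) / 2 = 1 from rfl]
  rw [show 1 + (m + 1) = (m + 1) + 1 by omega, Nat.choose_succ_self_right,
    show m + 1 + 1 - 1 = m + 1 by omega, show m + 1 - 1 = m by omega, Nat.choose_succ_self_right]
  push_cast
  ring

/-! ## (cota) is the tree's `linC` -/

/-- `movasatiBound (2k) d = C_{1^{k+1},(d−1)^{k+1}}` in degree `d` (the tree's `Kloosterman2023.linC`), `d ≥ 3`.
[cite: Villaflorloyola2021, (cota)] [cite: DuqueFrancoVillaflor2025Join, Rem. 7.1] -/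
theorem movasatiBound_eq_linC (k d : ℕ) (hd : 3 ≤ d) :
    movasatiBound (2 * k) d = (linC (k + 1) (k + 1) d : ℤ) := by
  have h := linC_closed_form (k + 1) k d hd
  have h' : ((linC (k + 1) (k + 1) d : ℕ) : ℤ) + (((k + 1) ^ 2 : ℕ) : ℤ) = (((k + d).choose d : ℕ) : ℤ) := by
    exact_mod_cast h
  unfold movasatiBound
  rw [show 2 * k / 2 = k by omega]
  linarith

/-! ## The complete intersection `(1,…,1,2)`: its Hilbert function as a join -/

/-- Leading linear generators do not change the Hilbert function. [cite: Kloosterman2023, §2 eq. (1)] -/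
theorem ciHilbert_replicate_one_append (a : ℕ) (l : List ℕ) (s : ℕ) :
    ciHilbert (List.replicate a 1 ++ l) s = ciHilbert l s := by
  induction a with
  | zero => rfl
  | succ a ih => rw [List.replicate_succ, List.cons_append, ciHilbert_one_cons, ih]

/-- Kloosterman's `h_I(e)` for the complete intersection `(1^{j+1}, 2)` in a degree-`e` hypersurface of
`ℙ^{2j+3}`: the ideal `I` has multidegree `(1^{j+1}, 2, e−2, (e−1)^{j+1})` (Prop. 3.2), so
`h_I = h(2, e−2, (e−1)^{j+1})`. [cite: Kloosterman2023, Prop. 3.2] -/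
theorem ciLocusCodim_ones_two (j e : ℕ) :
    ciLocusCodim (List.replicate (j + 1) 1 ++ [2]) e =
      ciHilbert (2 :: (e - 2) :: List.replicate (j + 1) (e - 1)) e := by
  have h : propIdealDegrees (List.replicate (j + 1) 1 ++ [2]) e =
      List.replicate (j + 1) 1 ++ (2 :: (e - 2) :: List.replicate (j + 1) (e - 1)) := by
    simp [propIdealDegrees, List.reverse_replicate, List.map_replicate]
  unfold ciLocusCodim
  rw [h, ciHilbert_replicate_one_append]

/-- … which is the join `φ₃ * (φ_{e−1} * φ_e^{*(j+1)})` of DFV's convolution calculus (`e = m + 3`):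
`h(ℂ[t]/t²) = φ₃`, `h(ℂ[t]/t^{m+1}) = φ_{m+2}`, `h((t^{m+2})^{j+1}) = φ_{m+3}^{*(j+1)}`.
[cite: DuqueFrancoVillaflor2025Join, Cor. 6.1, Ex. 6.1, Rem. 6.1] [cite: Kloosterman2023, §2 eq. (1)] -/
theorem ciHilbert_two_cons (m j : ℕ) :
    ciHilbert (2 :: (m + 3 - 2) :: List.replicate (j + 1) (m + 3 - 1)) =
      conv (pointHF 3) (conv (pointHF (m + 2)) (linearCycleHF (j + 1) (m + 3))) := by
  have h3 : pointHF 3 = ciHilbert [2] := pointHF_eq_ciHilbert 3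
  have hm : pointHF (m + 2) = ciHilbert [m + 1] := pointHF_eq_ciHilbert (m + 2)
  rw [h3, hm, linearCycleHF_eq_ciHilbert, show m + 3 - 2 = m + 1 by omega,
    ciHilbert_cons_eq_conv 2 ((m + 1) :: List.replicate (j + 1) (m + 3 - 1)),
    ciHilbert_cons_eq_conv (m + 1) (List.replicate (j + 1) (m + 3 - 1))]

/-! ## The identity: Thm. 1.3's bound is the `(1,…,1,2)` complete-intersection codimension (`d ≥ 4`) -/

/-- Integral form: for `k = j+1 ≥ 1` and `d = m+3 ≥ 4`,
`2·h_I(d) + 3k(k+3) + 4 = 2·C(k+d, k) + 2·C(k+d−1, k)` for the `(1^k, 2)` complete intersection.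
[cite: Villaflorloyola2021, Thm. 1.3 (equality case) and Abstract] [cite: Kloosterman2023, Prop. 3.2] -/
theorem two_mul_ciLocusCodim_ones_two (m j : ℕ) (hm : 1 ≤ m) :
    2 * ciLocusCodim (List.replicate (j + 1) 1 ++ [2]) (m + 3) + (3 * (j + 1) * (j + 4) + 4) =
      2 * (m + j + 4).choose (j + 1) + 2 * (m + j + 3).choose (j + 1) := by
  -- the (1,…,1,2) Hilbert function as a double window over the linear-cycle one
  have hX : ciLocusCodim (List.replicate (j + 1) 1 ++ [2]) (m + 3) =
      conv (conv (linearCycleHF (j + 1) (m + 3)) (pointHF (m + 2))) (pointHF 3) (m + 3) := by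
    rw [ciLocusCodim_ones_two, ciHilbert_two_cons, conv_comm (pointHF 3), conv_comm (pointHF (m + 2))]
  -- outer window `φ₃`: H(d) = G(d−1) + G(d)
  have e1 := conv_pointHF_add (conv (linearCycleHF (j + 1) (m + 3)) (pointHF (m + 2))) (d := 3)
    (by omega) (m + 3)
  rw [show m + 3 + 2 - 3 = m + 2 by omega] at e1
  have r1 := Finset.sum_range_succ (conv (linearCycleHF (j + 1) (m + 3)) (pointHF (m + 2))) (m + 3)
  have r2 := Finset.sum_range_succ (conv (linearCycleHF (j + 1) (m + 3)) (pointHF (m + 2))) (m + 2)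
  -- inner window `φ_{d−1}`: G(d−1) + L0 + L1 = Σ_{a<d} L a and G(d) + L0 + L1 + L2 = Σ_{a ≤ d} L a
  have e2 := conv_pointHF_add (linearCycleHF (j + 1) (m + 3)) (d := m + 2) (by omega) (m + 2)
  rw [show m + 2 + 2 - (m + 2) = 2 by omega] at e2
  have e3 := conv_pointHF_add (linearCycleHF (j + 1) (m + 3)) (d := m + 2) (by omega) (m + 3)
  rw [show m + 3 + 2 - (m + 2) = 3 by omega] at e3
  have s0 := Finset.sum_range_one (linearCycleHF (j + 1) (m + 3))
  have s1 := Finset.sum_range_succ (linearCycleHF (j + 1) (m + 3)) 1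
  have s2 := Finset.sum_range_succ (linearCycleHF (j + 1) (m + 3)) 2
  -- the `(j+2)`-fold linear cycle: L⁺(d−1) + L0 = Σ_{a<d} L a and L⁺(d) + L0 + L1 = Σ_{a ≤ d} L a
  have e4 := conv_pointHF_pred (linearCycleHF (j + 1) (m + 3)) m
  have e5 := conv_pointHF_top (linearCycleHF (j + 1) (m + 3)) m
  -- printed values of the linear-cycle Hilbert functions
  obtain ⟨hlow, -, -⟩ := linearCycleHF_values m j
  obtain ⟨-, hpred, htop⟩ := linearCycleHF_values m (j + 1)
  have hrec : linearCycleHF (j + 1 + 1) (m + 3) =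
      conv (linearCycleHF (j + 1) (m + 3)) (pointHF (m + 3)) := rfl
  rw [hrec, show m + 2 + (j + 1) = m + j + 3 by omega] at hpred
  rw [hrec, show m + 3 + (j + 1) = m + j + 4 by omega] at htop
  have hL1 : linearCycleHF (j + 1) (m + 3) 1 = j + 1 := by
    rw [hlow 1 (by omega), Nat.add_comm, Nat.choose_succ_self_right]
  have hL2 : 2 * linearCycleHF (j + 1) (m + 3) 2 = (j + 2) * (j + 1) := by
    -- `2·C(j+2,2) = (j+2)(j+1)` (as in `Roy2013.two_mul_choose_two`, not imported to keep the closure small)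
    rw [hlow 2 (by omega), ← Nat.choose_symm_add, Nat.add_comm 2 j, Nat.choose_two_right,
      show j + 2 - 1 = j + 1 from rfl]
    exact Nat.mul_div_cancel' (even_iff_two_dvd.mp (by
      rw [mul_comm]; exact Nat.even_mul_succ_self (j + 1)))
  -- canonical numerals (`m+3+1 = m+4` etc.), so that the sums below are literally the same terms
  rw [show m + 3 + 1 = m + 4 from rfl] at e1 r1 e3
  rw [show m + 2 + 1 = m + 3 from rfl] at r2 e2
  rw [show (1 : ℕ) + 1 = 2 from rfl] at s1
  rw [show (2 : ℕ) + 1 = 3 from rfl] at s2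
  -- bookkeeping: h_I(d) + L1 + L2 = L⁺(d−1) + L⁺(d)
  have key : ciLocusCodim (List.replicate (j + 1) 1 ++ [2]) (m + 3) +
      linearCycleHF (j + 1) (m + 3) 1 + linearCycleHF (j + 1) (m + 3) 2 =
      conv (linearCycleHF (j + 1) (m + 3)) (pointHF (m + 3)) (m + 2) +
        conv (linearCycleHF (j + 1) (m + 3)) (pointHF (m + 3)) (m + 3) := by
    omega
  nlinarith [key, hpred, htop, hL1, hL2]

/-- THE IDENTITY: for `n = 2k ≥ 2` and `d ≥ 4`, Thm. 1.3's bound equals Kloosterman's codimension `h_I(d)` of the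
Zariski tangent space of the Hodge locus of a complete intersection of type `(1,…,1,2)` — "the ones associated
to a complete intersection cycle of type `(1,1,…,1,2)` attain the minimal possible codimension".
[cite: Villaflorloyola2021, Thm. 1.3 and Abstract] [cite: Kloosterman2023, Prop. 3.2 and Prop. 4.13] -/
theorem secondGapBound_eq_ciLocusCodim (k d : ℕ) (hk : 1 ≤ k) (hd : 4 ≤ d) :
    secondGapBound (2 * k) d = (ciLocusCodim (List.replicate k 1 ++ [2]) d : ℚ) := by
  obtain ⟨j, rfl⟩ : ∃ j, k = j + 1 := ⟨k - 1, by omega⟩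
  obtain ⟨m, rfl⟩ : ∃ m, d = m + 3 := ⟨d - 3, by omega⟩
  have main := two_mul_ciLocusCodim_ones_two m j (by omega)
  have main' : (2 : ℚ) * (ciLocusCodim (List.replicate (j + 1) 1 ++ [2]) (m + 3) : ℚ) +
      (3 * ((j : ℚ) + 1) * ((j : ℚ) + 4) + 4) =
      2 * ((m + j + 4).choose (j + 1) : ℚ) + 2 * ((m + j + 3).choose (j + 1) : ℚ) := by
    exact_mod_cast main
  have c1 : (j + 1 + (m + 3)).choose (m + 3) = (m + j + 4).choose (j + 1) := by
    rw [← Nat.choose_symm_add, show j + 1 + (m + 3) = m + j + 4 by omega]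
  have c2 : (j + 1 + (m + 3) - 1).choose (m + 3 - 1) = (m + j + 3).choose (j + 1) := by
    rw [show j + 1 + (m + 3) - 1 = (j + 1) + (m + 2) by omega, show m + 3 - 1 = m + 2 by omega,
      ← Nat.choose_symm_add, show j + 1 + (m + 2) = m + j + 3 by omega]
  unfold secondGapBound
  rw [show 2 * (j + 1) / 2 = j + 1 by omega, c1, c2]
  push_cast
  linarith

/-! ## Values, and the failure at `d = 3` -/

/-- `(n,d) = (4,4)`: the second value is `8` (tangent codimension of the quadric-surface / `CI(1,1,2)` locus in
quartic fourfolds); `(6,4) ↦ 26`, `(4,5) ↦ 19`, `(4,6) ↦ 32` (the `(1,1,2)` entry of Movasati's sextic-fourfold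
table), `(8,4) ↦ 61`. [cite: Villaflorloyola2021, Thm. 1.3] [cite: Kloosterman2023, Prop. 3.2] -/
theorem secondGapBound_values :
    secondGapBound 4 4 = 8 ∧ secondGapBound 6 4 = 26 ∧ secondGapBound 4 5 = 19 ∧
    secondGapBound 4 6 = 32 ∧ secondGapBound 8 4 = 61 := by
  have v1 : ciLocusCodim (List.replicate 2 1 ++ [2]) 4 = 8 := by decide
  have v2 : ciLocusCodim (List.replicate 3 1 ++ [2]) 4 = 26 := by decide
  have v3 : ciLocusCodim (List.replicate 2 1 ++ [2]) 5 = 19 := by decide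
  have v4 : ciLocusCodim (List.replicate 2 1 ++ [2]) 6 = 32 := by decide
  have v5 : ciLocusCodim (List.replicate 4 1 ++ [2]) 4 = 61 := by decide
  have h1 := secondGapBound_eq_ciLocusCodim 2 4 (by norm_num) (by norm_num)
  have h2 := secondGapBound_eq_ciLocusCodim 3 4 (by norm_num) (by norm_num)
  have h3 := secondGapBound_eq_ciLocusCodim 2 5 (by norm_num) (by norm_num)
  have h4 := secondGapBound_eq_ciLocusCodim 2 6 (by norm_num) (by norm_num)
  have h5 := secondGapBound_eq_ciLocusCodim 4 4 (by norm_num) (by norm_num)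
  rw [v1] at h1; rw [v2] at h2; rw [v3] at h3; rw [v4] at h4; rw [v5] at h5
  norm_num at h1 h2 h3 h4 h5
  exact ⟨h1, h2, h3, h4, h5⟩

/-- `d = 3` is excluded ("`d ≥ max{4, 2+6/n}`"; Remark 4.1: at `(4,3)` every local Hodge locus attains (des1)):
at the cubic fourfold Thm. 1.3's expression is `−1`, while the `CI(1,1,2)` tangent codimension and (cota) both
equal `1` (`h^{3,1} = 1`). [cite: Villaflorloyola2021, Thm. 1.3 and Remark 4.1] -/
theorem secondGapBound_cubic_fourfold :
    secondGapBound 4 3 = -1 ∧ ciLocusCodim (List.replicate 2 1 ++ [2]) 3 = 1 ∧ movasatiBound 4 3 = 1 := by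
  have h : secondGapBound 4 3 = ((Nat.choose 5 3 : ℕ) : ℚ) + ((Nat.choose 4 2 : ℕ) : ℚ) -
      (3 * ((4 : ℕ) : ℚ) ^ 2 / 8 + 9 * ((4 : ℕ) : ℚ) / 4 + 2) := rfl
  refine ⟨?_, by decide, by decide⟩
  rw [h, show Nat.choose 5 3 = 10 by decide, show Nat.choose 4 2 = 6 by decide]
  norm_num

end Literature.AlgebraicGeometry.Villaflor2022
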